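import Summits.Ventures.HodgeKum4.Theses.KummerFixedLocus
import Summits.Ventures.HodgeKum4.Theorems.LaneVDefs
import Summits.Ventures.HodgeKum4.Theorems.KummerFixedLocusKummerDivisorClassLefschetz
import Summits.Ventures.HodgeKum4.Theorems.KummerFixedLocusKummerRangeEqInvariants
import Summits.Ventures.HodgeKum4.Theorems.KummerFixedLocusHilbertKummerTransfer
import Literature.AlgebraicGeometry.HilbertScheme.LefschetzDualHilbertScheme
import Literature.AlgebraicGeometry.HilbertScheme.LefschetzDualTransfer
import Literature.AlgebraicGeometry.HilbertScheme.HilbertSchemeOfPointsExists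
import Literature.AlgebraicGeometry.HilbertScheme.PoincareCasimirElement
import Literature.AlgebraicGeometry.Hyperkaehler.GeneralizedKummerHilbertSchemePullback
import Literature.AlgebraicGeometry.Hyperkaehler.GeneralizedKummerTypeCohomologyTransport
import Literature.AlgebraicGeometry.Hyperkaehler.LLVStructureKummerType
import Literature.AlgebraicGeometry.Hyperkaehler.IrreducibleSymplecticOfDeformationType
import Literature.AlgebraicGeometry.Hyperkaehler.IrreducibleSymplecticOddCohomology
import Literature.AlgebraicGeometry.HodgeTheory.PolarizationClassExists
import Literature.AlgebraicGeometry.HodgeTheory.DualLefschetzInLefschetzInvolutionAlgebraHolds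
import Literature.AlgebraicGeometry.HodgeTheory.ComplexConjugationHolds
import Literature.AlgebraicGeometry.Motives.AbelianVarietyProjectiveChart
import Literature.AlgebraicGeometry.Surfaces.K3LatticeInvariantsProofs
import HarnessLib

/-!
**v6 (plan g18 generator mk_v6.py): stub 2 (V0) folded through `Summit.Ventures.HodgeKum4.HilbertKummer.hilbertKummerTransfer_of_print'`; registered stubs = 2: `stub_LefschetzGenerationHilb5`, `stub_print`.**

# Line `laneV` for the crux `LefschetzGenerationKum4` (L1) of route `KummerFixedLocus` — REGISTERED SKELETON

Crux item `stmt-Ventures-19134`, decl `Summit.Ventures.HodgeKum4.Theses.KummerFixedLocus.LefschetzGenerationKum4`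
(= `Summit.Ventures.HodgeKum4.LefschetzGenerationKum4`: for every smooth projective `X` of `Kum⁴`-type and every
`sl₂`-triple `(L_ℓ, h, Λ)`, the `Γ(X)`-invariant classes lie in the `(Λ, ∪)`-span of `H⁰ ⊕ H² ⊕ H³`).

**The line (lane (V); director-hodge g7 2026-08-27T07:22:44Z / 07:47:55Z, shape (α) of J's pre-read
e04f3ef14233df2b; planner hodge-kum4-plan g16).**  `L1 ⇐ L1-Hilb(5) ∧ V0 ∧ bridge ∧ seams S1–S3 ∧ print`:
generation of `H*(A^[5])` from `H^{≤3}` by cup product and the transferred dual Lefschetz operator (Li–Qin–Wang /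
Nakajima Fock space; `Theorems/LaneVDefs.lean`), transferred to the Kummer fibre `K⁴(A) ⊂ A^[5]` (V0 + bridge), then
to every `X` of `Kum⁴`-type by the print-synthesis fact T₄ (`HassettTschinkel2013_autZero_cohomologyTransport_kumType`,
with its PROVED consumer `invariantClasses_le_opCupSpan_of_kummer`).  D3 (`(∪D_α, h, f_α)` is an `sl₂`-triple) is the
Literature THEOREM `ChernCharacterOperators.isDualLefschetz_transferOp` and is used inside the proof, not stubbed.

**Stubs (2 = the registered obligations; sorries = stubs, nowhere else; v6, planner g19 2026-08-27: V0 FOLDED — see below).**  (Planner g17 fold, 2026-08-27, director-hodge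
g7 08:46:24Z + REF-AUDIT-39 f-1: the seams S1 and S2 of the g16 draft are no longer stubs — S2 is PROVED below from the
Literature theorem `exists_isCasimir_mem_evenTensorSpan` (p513175), S1 is PROVED below from the Grothendieck–Fogarty
existence fact, which therefore joins the print bundle as its fifth conjunct (a stub whose only discharge consumes a
named fact is not attackable as typed — f-1).  S3 fold, prover p1 g4 2026-08-27: seam S3 is PROVED below modulo print
from `Theorems.KummerFixedLocusKummerDivisorClassLefschetz.hasDualLefschetz_map_divisorClass` (p521059: D3 + the
instance-free Lefschetz transfer along Beauville's cover), whose two further print inputs — the Galois-cover fact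
`Beauville1983_kummerCover_galois` (also V0's input) and the Verbitsky–Looijenga–Lunts–Fujiki criterion
`Verbitsky1996_hasDualLefschetz_of_topPower_ne_zero` (p519145) — join the print bundle as conjuncts six and seven.)
* `stub_LefschetzGenerationHilb5 : LefschetzGenerationHilbW 5` — L1-Hilb(5), `W`-FORM (route item, crux rank 2, restated
  (ρ3): ONE zero-mode instance `𝔊` with `𝔊.IsWZeroModes`, from the print conjunct
  `LiQinWang2002W_chernCharacter_zeroModes_abelianSurface`; feeder `lefschetzGenerationKumAt_kummer_of_hilbW`); its own line is
  the V2 skeleton; evidence: `Literature.Computation.AbelianHilbFock.fullClosure5`, `allN10_d8`, `lieCertificate`).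
* (v6: NO LONGER A STUB) V0 `HilbertKummerTransfer` in its PRINT-ANTECEDENT form (route item stmt-Ventures-20354, crux rank 3,
  restated (C-b′)) is PROVED in the tree by seat p2: `Summit.Ventures.HodgeKum4.HilbertKummer.hilbertKummerTransfer_of_print' :
  Beauville1983_irreducibleSymplectic_of_kummerType → Beauville1983_kummerCover_galois → HilbertKummerTransfer`
  (`Theorems/KummerFixedLocusHilbertKummerTransfer.lean`, p529644; the item is CLOSED·proved by its by-name twin
  `Summit.Ventures.HodgeKum4.hilbertKummerTransfer_of_print`); the composition applies it to `stub_print` conjuncts 2 and 6.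
* `stub_print` — the EIGHT named print facts as ONE registered obligation (conditional forever, like every named fact):
  `LiQinWang2002W_chernCharacter_zeroModes_abelianSurface ∧ Beauville1983_irreducibleSymplectic_of_kummerType ∧
  LooijengaLuntsVerbitsky_llvStructure_kumType ∧ HassettTschinkel2013_autZero_cohomologyTransport_kumType ∧
  Fogarty1968_hilbertScheme_surface ∧ Beauville1983_kummerCover_galois ∧
  Verbitsky1996_hasDualLefschetz_of_topPower_ne_zero ∧ BNWS2011_autFixingH2H3_generalizedKummer`.
The bridge `KummerRangeEqInvariants` (route item `stmt-Ventures-20143`, formerly stub 3) is PROVED modulo print below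
(`kummerRangeEqInvariants_of_print`, `Theorems/KummerFixedLocusKummerRangeEqInvariants.lean`: the Galois-cover fact +
BNWS, conjuncts 6 and 8).
Proved in this file (no longer obligations): seam S1 `kummerFibreOfInstance_of_fogarty : Fogarty1968_hilbertScheme_surface →
KummerFibreOfInstance` (via `IsGeneralizedKummerVarietyOf.exists_hilbertSchemesOfPoints`, p514830), seam S2
`poincareEvenCasimirExists_holds : PoincareEvenCasimirExists` (via `exists_isCasimir_mem_evenTensorSpan`, p513175), and seam
S3 `kummerDivisorClassLefschetz_of_print : Beauville1983_irreducibleSymplectic_of_kummerType → Beauville1983_kummerCover_galois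
→ Verbitsky1996_hasDualLefschetz_of_topPower_ne_zero → KummerDivisorClassLefschetz` (via `hasDualLefschetz_map_divisorClass`,
p521059).

**Composition** `LefschetzGenerationKum4_of : …Theses.KummerFixedLocus.LefschetzGenerationKum4` — the stubs applied
BY NAME to the kernel feeder `lefschetzGenerationKum4_of_laneV` (no free hypotheses; sorry-free outside the stubs).

Honest framing: registering this skeleton proves a composition only.  Nothing here says L1, L1-Hilb(5), V0, any seam,
`HC_Kum4Type` or HC is proved; every named fact is a hypothesis by design.
-/

noncomputable section

open CategoryTheory MonoidalCategory CartesianMonoidalCategory TensorProduct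
open Literature.AlgebraicTopology.SingularHomology
open Literature.AlgebraicGeometry Literature.AlgebraicGeometry.Hyperkaehler Literature.AlgebraicGeometry.HilbertScheme
open Literature.AlgebraicGeometry.HodgeTheory (complexBetti)

namespace Summit.Ventures.HodgeKum4.Cruxes.LefschetzGenerationKum4.LaneV

open scoped MonObj
open Literature.AlgebraicGeometry.HodgeTheory
open Literature.AlgebraicGeometry.Motives (AbelianVariety)

/-! ### §1 The seams S1–S3 (statements) and the lane-(V) output at `K⁴(A)` -/

/-- **SEAM S1 (instance seam).**  Every generalized Kummer variety `K` of an abelian surface `A` — by definition a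
Kummer fibre of SOME Hilbert-scheme model `(H', Ξ')` of `n + 1` points — is a Kummer fibre of the `(n+1)`-st member
`H.obj (n + 1)` of some FULL choice `H : HilbertSchemesOfPoints A.X` of Hilbert schemes of points of `A` (the
carrier of the lane-(V) Fock space).  Discharged below (`kummerFibreOfInstance_of_fogarty`) from the Grothendieck–Fogarty existence fact
`Fogarty1968_hilbertScheme_surface` (REFEREED, `HilbertSchemeOfPointsExists.lean`, p514830) by overriding one member of a
full choice by `(H', Ξ')` (`IsGeneralizedKummerVarietyOf.exists_hilbertSchemesOfPoints`, kernel). -/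
def KummerFibreOfInstance : Prop :=
  ∀ ⦃n : ℕ⦄ ⦃A : AbelianVariety ℂ⦄ ⦃K : Motives.SchemeOver ℂ⦄, A.dim = 2 →
    IsGeneralizedKummerVarietyOf n A K →
      ∃ (H : HilbertSchemesOfPoints A.X) (𝒜 : Motives.Jacobian (H.obj (n + 1)))
        (x₀ : 𝟙_ (Motives.SchemeOver ℂ) ⟶ H.obj (n + 1)) (j : K ⟶ H.obj (n + 1)),
        IsPullback j (toUnit K) (lift (𝟙 (H.obj (n + 1))) (toUnit (H.obj (n + 1)) ≫ x₀) ≫ 𝒜.diff)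
          (1 : 𝟙_ (Motives.SchemeOver ℂ) ⟶ 𝒜.J.X)

/-- **SEAM S2 (even Casimir tensor).**  The Poincaré pairing of a smooth projective surface has a Casimir tensor
`C = Σᵢ eᵢ ⊗ εᵢ` lying in the EVEN part of `H* ⊗ H*` (kernel from Poincaré duality: the pairing is perfect on the
finite-dimensional `H*(S(ℂ); ℂ)` and pairs `Hⁱ` with `H⁴⁻ⁱ`, so the Künneth class of the diagonal has only
components of bidegree `(i, 4 - i)`, total parity even).  PROVED below (`poincareEvenCasimirExists_holds`) from the
Literature theorem `exists_isCasimir_mem_evenTensorSpan` (`PoincareCasimirElement.lean`, p513175). -/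
def PoincareEvenCasimirExists : Prop :=
  ∀ ⦃S : Motives.SchemeOver ℂ⦄ (hS : Motives.IsSmoothProjective 2 S),
    ∃ C : totalCohomology ℂ (Motives.ComplexPoints S) ⊗[ℂ] totalCohomology ℂ (Motives.ComplexPoints S),
      C ∈ evenTensorSpan ℂ (coeffFamily S) ∧ IsCasimir ℂ (poincarePairing hS) C

/-- **SEAM S3 (a Lefschetz class on the Kummer fibre coming from the surface).**  For a polarization class `α` of
the abelian surface `A` and a Kummer fibre `j : K ⟶ A^[n+1]` (`n ≥ 1`, `K` smooth projective of dimension `2n`), the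
class `θ*(D_α)` — `D_α = G₀(α, n+1) = 𝔊.divisorClass (n+1) α` — has a dual Lefschetz operator on `H*(K(ℂ); ℂ)`.
Source: Beauville 1983 §7 Prop. 8 (`H²(Kⁿ(A)) ⊃ H²(A)` with `q` restricting to the intersection form, so
`q(θ*D_α) = α² > 0`) + Looijenga–Lunts 1997 (4.5)–(4.7) / Verbitsky (for hyper-Kähler manifolds a class with
`q ≠ 0` has the Lefschetz property).  PROVED below modulo print (`kummerDivisorClassLefschetz_of_print`), by an
INSTANCE-FREE route that never identifies `𝔊.divisorClass` with a geometric class: D3 makes `D_α` Lefschetz on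
`A^[n+1]` for every `𝔊`, and `Theorems.KummerFixedLocusKummerDivisorClassLefschetz.hasDualLefschetz_map_kummerFibre`
transfers the Lefschetz property of ANY class along `θ` (top power, Beauville's cover `Θ`, Künneth, the
Verbitsky–Looijenga–Lunts–Fujiki criterion `Verbitsky1996_hasDualLefschetz_of_topPower_ne_zero`). -/
def KummerDivisorClassLefschetz : Prop :=
  ∀ ⦃n : ℕ⦄ ⦃A : AbelianVariety ℂ⦄ ⦃K : Motives.SchemeOver ℂ⦄ (hA : A.dim = 2), 1 ≤ n →
    ∀ (hS : Motives.IsSmoothProjective 2 A.X) (H : HilbertSchemesOfPoints A.X) (𝔊 : ChernCharacterOperators hS H)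
      (𝒜 : Motives.Jacobian (H.obj (n + 1))) (x₀ : 𝟙_ (Motives.SchemeOver ℂ) ⟶ H.obj (n + 1))
      (j : K ⟶ H.obj (n + 1)),
      IsPullback j (toUnit K) (lift (𝟙 (H.obj (n + 1))) (toUnit (H.obj (n + 1)) ≫ x₀) ≫ 𝒜.diff)
        (1 : 𝟙_ (Motives.SchemeOver ℂ) ⟶ 𝒜.J.X) →
      Motives.IsSmoothProjective (2 * n) K →
      ∀ (α : complexBetti A.X 2), IsPolarizationClass 2 A.X α →
        HasDualLefschetz (2 * n) (complexBetti.map j 2 (𝔊.divisorClass (n + 1) α))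

/-- **L1 at every ALGEBRAIC generalized Kummer eightfold** (the lane-(V) output before the `Kum⁴`-type transport;
literally the hypothesis `hKum` of T₄'s consumer `invariantClasses_le_opCupSpan_of_kummer` at `n = 4`, `N = 8`,
`D = {0, 2, 3}`): for every abelian surface `A`, every generalized Kummer variety `K = K⁴(A)` (smooth projective of
dimension `8`) and every `sl(2)`-triple `(L_ℓ, h, Λ)` on `H*(K(ℂ); ℂ)`: `H*(K)^{Γ(K)} ⊆ ⟨H⁰, H², H³⟩_{(Λ, ∪)}`. -/
def LefschetzGenerationKummer4Alg : Prop :=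
  ∀ ⦃A : AbelianVariety ℂ⦄ ⦃K : Motives.SchemeOver ℂ⦄, A.dim = 2 → IsGeneralizedKummerVarietyOf 4 A K →
    Motives.IsSmoothProjective (2 * 4) K →
    ∀ (ℓ : complexBetti K 2) (Λ : Module.End ℂ (totalCohomology ℂ (Motives.ComplexPoints K))),
      IsDualLefschetz 8 ℓ Λ → LefschetzGenerationKumAt K Λ

/-! ### §2 Helper lemmas and the kernel feeder (proved; hypotheses explicit) -/

/-- `b₁ = 0` for a smooth projective generalized Kummer variety (`n ≥ 1`): it is irreducible symplectic (Beauville),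
hence simply connected. -/
theorem complexBetti_one_eq_zero_of_kummer (hBe : Beauville1983_irreducibleSymplectic_of_kummerType) {n : ℕ}
    (hn : 1 ≤ n) {A : AbelianVariety ℂ} {K : Motives.SchemeOver ℂ} (hA : A.dim = 2)
    (hK : IsGeneralizedKummerVarietyOf n A K) (hKs : Motives.IsSmoothProjective (2 * n) K)
    (x : complexBetti K 1) : x = 0 := by
  have hI := Beauville1983_irreducibleSymplectic_of_kummerType.generalizedKummer hBe hn hA hK hKs
  haveI : SimplyConnectedSpace (Motives.ComplexPoints K) := hI.2.1
  haveI := ModuleCat.subsingleton_of_isZero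
    (isZero_singularCohomology_one_of_simplyConnectedSpace (X := Motives.ComplexPoints K) ℂ)
  exact Subsingleton.elim x 0

/-- **`h ≠ 0` on every member of a chosen family of Hilbert schemes** (the side condition `hh` of D3 /
`lefschetzGenerationKumAt_of_hilb`): `A^[m]` is smooth projective, so `dim H⁰(A^[m](ℂ); ℂ) = 1`
(`Surfaces.finrank_complexBetti_zero`) and `h` acts on `H⁰ ≠ 0` by the nonzero scalar `0 - 2m` … precisely
`Hyperkaehler.degreeOperator_ne_zero_of_ne_zero` with `k = 0 ≠ N = 2m` (`m ≥ 1`). -/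
theorem degreeOperator_hilbObj_ne_zero {S : Motives.SchemeOver ℂ} (H : HilbertSchemesOfPoints S) {m : ℕ}
    (hm : 1 ≤ m) : degreeOperator ℂ (Motives.ComplexPoints (H.obj m)) (2 * m) ≠ 0 := by
  haveI : Nontrivial (complexBetti (H.obj m) 0) := Module.nontrivial_of_finrank_pos (R := ℂ)
    (by rw [Literature.AlgebraicGeometry.Surfaces.finrank_complexBetti_zero (H.smooth m)]; exact Nat.one_pos)
  obtain ⟨x, hx⟩ := exists_ne (0 : complexBetti (H.obj m) 0)
  exact degreeOperator_ne_zero_of_ne_zero (k := 0) (N := 2 * m) (by omega) hx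

/-- **THE LANE-(V) OUTPUT: L1 at every algebraic `K⁴(A)`** from L1-Hilb(5) in `W`-form (ONE zero-mode instance),
V0, the bridge, the three small seams S1–S3 and the named print facts (Li–Qin–Wang's Chern character operators as
`W`-algebra zero-modes on an abelian surface; Beauville's `Kⁿ(A)` is IHS; the LLV structure of `Kumⁿ`-type); D3 is
the Literature theorem used inside `lefschetzGenerationKumAt_kummer_of_hilbW`.  CONDITIONAL on all binders; nothing
is proved outright. -/
theorem lefschetzGenerationKummer4Alg_of_laneV
    (hLQWW : LiQinWang2002W_chernCharacter_zeroModes_abelianSurface)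
    (hBe : Beauville1983_irreducibleSymplectic_of_kummerType)
    (hF : LooijengaLuntsVerbitsky_llvStructure_kumType)
    (hL5 : LefschetzGenerationHilbW 5) (hV0 : HilbertKummerTransfer) (hB : KummerRangeEqInvariants)
    (hS1 : KummerFibreOfInstance) (hS2 : PoincareEvenCasimirExists) (hS3 : KummerDivisorClassLefschetz) :
    LefschetzGenerationKummer4Alg := by
  intro A K hA hK hKs ℓ Λ hΛ
  -- the instance carrying the Fock space, with `K` as a Kummer fibre of `A^[5] = H.obj 5`
  obtain ⟨H, 𝒜, x₀, j, hsq⟩ := hS1 hA hK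
  have hS : Motives.IsSmoothProjective 2 A.X := hA ▸ AbelianVariety.isSmoothProjective_holds
  obtain ⟨𝔊, -, h𝔊⟩ := hLQWW A hA hS H
  obtain ⟨C, hCg, hC⟩ := hS2 hS
  -- a polarization class `α` of `A`, Lefschetz on `A`, with `θ*(D_α)` Lefschetz on `K`
  obtain ⟨α, -, -, hα⟩ := exists_isPolarizationClass_mem_algebraicClasses hS
  obtain ⟨Λ_A, hΛA⟩ := IsPolarizationClass.hasDualLefschetz (n := 2) two_pos hS hα
  obtain ⟨Λ₀, hΛ₀⟩ := hS3 hA (n := 4) (by norm_num) hS H 𝔊 𝒜 x₀ j hsq hKs α hα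
  -- `b₁(K) = 0`, `h_{A^[5]} ≠ 0`, `K` of `Kum⁴`-type; then the v2 glue (all triples at once)
  have h1 : ∀ x : complexBetti K 1, x = 0 :=
    complexBetti_one_eq_zero_of_kummer hBe (n := 4) (by norm_num) hA hK hKs
  have hh := degreeOperator_hilbObj_ne_zero H (m := 4 + 1) (by norm_num)
  obtain ⟨M⟩ := nonempty_hodgeModel_holds hKs
  exact lefschetzGenerationKumAt_kummer_of_hilbW hV0 hB hF (n := 4) hL5 hA (by norm_num) hS H 𝔊 h𝔊 hCg hC hh 𝒜 x₀ j
    hsq hKs (IsOfGeneralizedKummerType.of_hodgeModel hA hK hKs M) h1 hΛA hΛ₀ ℓ Λ hΛ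

/-- **THE FEEDER `lefschetzGenerationKum4_of_laneV`** = the conditional proof of the rev-20 SPLIT GLUE
`LefschetzGenerationHilbW 5 → HilbertKummerTransfer → KummerRangeEqInvariants → LefschetzGenerationKum4`: the chain
`L1-HilbW(5) → V0 → bridge → (D3 thm, S1–S3, LQW-W, Beauville, LLV) → L1 at every K⁴(A) → (T₄ fact + its proved
consumer) → LefschetzGenerationKum4`.  CONDITIONAL on every binder; MODEL_X (item 19267), the frame complement and
`KummerTranslationFrameExists` are NOT used. -/
theorem lefschetzGenerationKum4_of_laneV
    (hT4 : HassettTschinkel2013_autZero_cohomologyTransport_kumType)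
    (hLQWW : LiQinWang2002W_chernCharacter_zeroModes_abelianSurface)
    (hBe : Beauville1983_irreducibleSymplectic_of_kummerType)
    (hF : LooijengaLuntsVerbitsky_llvStructure_kumType)
    (hS1 : KummerFibreOfInstance) (hS2 : PoincareEvenCasimirExists) (hS3 : KummerDivisorClassLefschetz)
    (hL5 : LefschetzGenerationHilbW 5) (hV0 : HilbertKummerTransfer) (hB : KummerRangeEqInvariants) :
    Summit.Ventures.HodgeKum4.LefschetzGenerationKum4 :=
  fun _X hX hXK ℓ Λ hΛ ↦
    HassettTschinkel2013_autZero_cohomologyTransport_kumType.invariantClasses_le_opCupSpan_of_kummer hT4 (n := 4)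
      (lefschetzGenerationKummer4Alg_of_laneV hLQWW hBe hF hL5 hV0 hB hS1 hS2 hS3) hX hXK ℓ Λ hΛ
/-! ### §3 The registered stubs (the ONLY sorries of this file) -/

/-- **STUB 1 = route item `LefschetzGenerationHilb5` (crux, rank 2), `W`-form (restate (ρ3)): L1-Hilb(5) at the
zero-mode instances.** -/
theorem stub_LefschetzGenerationHilb5 : Summit.Ventures.HodgeKum4.LefschetzGenerationHilbW 5 := by
  sorry

-- (v6) stub 2 `stub_HilbertKummerTransfer` FOLDED: V0 is the tree theorem `Summit.Ventures.HodgeKum4.HilbertKummer.hilbertKummerTransfer_of_print'` (item stmt-Ventures-20354).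

/-- **Seam S1, PROVED modulo print** (instance bookkeeping): from the Grothendieck–Fogarty existence fact, every
generalized Kummer variety of an abelian surface is a Kummer fibre of a member of a FULL choice of Hilbert schemes
(v0typer g2's glue; `hS` from `A.dim = 2`). -/
theorem kummerFibreOfInstance_of_fogarty (hGF : Fogarty1968_hilbertScheme_surface) : KummerFibreOfInstance :=
  fun _n _A _K hA hK ↦ hK.exists_hilbertSchemesOfPoints hGF (hA ▸ AbelianVariety.isSmoothProjective_holds)

/-- **Seam S2, PROVED** (even Casimir tensor of the Poincaré pairing of a smooth projective surface). -/
theorem poincareEvenCasimirExists_holds : PoincareEvenCasimirExists :=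
  fun _S hS ↦
    let ⟨C, hCg, hC⟩ := exists_isCasimir_mem_evenTensorSpan hS
    ⟨C, hCg, hC⟩

/-- **Seam S3, PROVED modulo print** (`θ*D_α` has a dual Lefschetz operator on the Kummer fibre): D3 (every
instance `𝔊`) composed with the instance-free Lefschetz transfer along Beauville's cover (`hasDualLefschetz_map_divisorClass`,
`Theorems/KummerFixedLocusKummerDivisorClassLefschetz.lean`, p521059); print inputs = Beauville's IHS theorem, the
Galois-cover fact (F6) and the Verbitsky–Looijenga–Lunts–Fujiki criterion, all from the print stub. -/
theorem kummerDivisorClassLefschetz_of_print (hBe : Beauville1983_irreducibleSymplectic_of_kummerType)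
    (hGal : Beauville1983_kummerCover_galois) (hV : Verbitsky1996_hasDualLefschetz_of_topPower_ne_zero) :
    KummerDivisorClassLefschetz :=
  fun _ _ _ hA hn hS H 𝔊 𝒜 x₀ j hsq hKs α hα ↦ hasDualLefschetz_map_divisorClass hBe hGal hV hA hn hS H 𝔊 𝒜 x₀ j hsq hKs α hα

/-- **STUB 3 = the print bundle** (eight NAMED Literature facts; conditional forever by design — a registered
skeleton admits no free hypotheses, so print enters the line as one stub; the first conjunct is Li–Qin–Wang IMRN 2002
Thm. 4.6 in zero-mode form (an instance `𝔊` with `𝔊.IsWZeroModes` exists — restate (ρ3)); the fifth, Grothendieck–Fogarty,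
is what seam S1 consumes; the sixth, Beauville's Galois cover `A × Kⁿ(A) → A^[n+1]`, and the seventh, the
Verbitsky–Looijenga–Lunts–Fujiki Lefschetz criterion, are what seam S3 consumes — the sixth is also V0's and the
bridge's input; the eighth, BNWS 2011 / Oguiso / Foster «Γ(Kⁿ(A)) = the Kummer translations», is the bridge's). -/
theorem stub_print :
    LiQinWang2002W_chernCharacter_zeroModes_abelianSurface ∧ Beauville1983_irreducibleSymplectic_of_kummerType ∧
      LooijengaLuntsVerbitsky_llvStructure_kumType ∧ HassettTschinkel2013_autZero_cohomologyTransport_kumType ∧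
        Fogarty1968_hilbertScheme_surface ∧ Beauville1983_kummerCover_galois ∧
          Verbitsky1996_hasDualLefschetz_of_topPower_ne_zero ∧ BNWS2011_autFixingH2H3_generalizedKummer := by
  sorry

/-! ### §4 The composition: concludes the crux BY NAME, stubs applied by name, no `sorry` -/

/-- **`LefschetzGenerationKum4_of`** — the line's kernel-checked composition: the three registered stubs give the
route decl `Summit.Ventures.HodgeKum4.Theses.KummerFixedLocus.LefschetzGenerationKum4` (= L1) through the feeder
`lefschetzGenerationKum4_of_laneV` (S1 from the print stub's Fogarty conjunct, S2 proved outright, S3 from the print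
stub's Beauville / Galois-cover / Verbitsky conjuncts). -/
theorem LefschetzGenerationKum4_of : Summit.Ventures.HodgeKum4.Theses.KummerFixedLocus.LefschetzGenerationKum4 :=
  lefschetzGenerationKum4_of_laneV stub_print.2.2.2.1 stub_print.1 stub_print.2.1 stub_print.2.2.1
    (kummerFibreOfInstance_of_fogarty stub_print.2.2.2.2.1) poincareEvenCasimirExists_holds
    (kummerDivisorClassLefschetz_of_print stub_print.2.1 stub_print.2.2.2.2.2.1 stub_print.2.2.2.2.2.2.1)
    stub_LefschetzGenerationHilb5 (Summit.Ventures.HodgeKum4.HilbertKummer.hilbertKummerTransfer_of_print' stub_print.2.1 stub_print.2.2.2.2.2.1)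
    (kummerRangeEqInvariants_of_print stub_print.2.2.2.2.2.1 stub_print.2.2.2.2.2.2.2)

#print axioms LefschetzGenerationKum4_of

end Summit.Ventures.HodgeKum4.Cruxes.LefschetzGenerationKum4.LaneV

end
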